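import Summits.Ventures.Crystal3D.Theorems.StickyWulffConstantCoaxialWallLawEndGap
import HarnessLib

/-!
# Exact end accounting for the word automaton, IV: the classes carried by a reading ball (word rigidity)

HONEST FRAMING. Part of the venture `Summits/Ventures/Crystal3D` (cell `crystal3d-full`), helper for the crux
`CoaxialWallLaw` (stmt-Ventures-19481) of `route-Ventures-StickyWulffConstant`, REGISTERED line `WallLedgerF`
(planner cf-p1 gen 16), open stub `stub_coaxialTwoSlabAdhesion` (general fillings).  Rung credit only; F-C1 not
moved.  Part of the EXACT END ACCOUNTING (`…EndGap`, `…ExactCount`, `…EndCharge`): the reachable ends at a ball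
`b` are images of MOVING states at the neighbours of `b`, and a moving state's ball carries very few certified
states, by WORD RIGIDITY (abstract hypothesis `hrigid`: two classes whose frames share a `60°` triangle of slots are
equal — `word_eq_of_triangle` at instantiation):

* `mem_shell_of_twinDozen` — the twelve contacts of a ball reading as a twin dozen of `(G, m)` are exactly its
  nine own slot balls and its three mirror balls (`card_contacts_eq_twelve_of_twinDozen`);
* `word_class_eq_of_full` — a ball with a FULL `F κ`-shell carries only the class `κ` (`shell_slot_of_full`);
* `word_class_of_twinDozen` — a ball READING AS A TWIN DOZEN of `(F κ, m)` carries the class `κ`, or else a class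
  whose frame has a `60°` triangle inside the mirrored dozen `(F κ ≫ R_m) '' fccSlots` (a `60°` triangle of
  contacts of an anticuboctahedron lies in the own or in the mirrored cuboctahedron: a lower polar ball and a
  mirror ball meet at `⟪·,·⟫ ≤ 1 − 4/3 < ½`).

WHAT THIS IS NOT: not the stub; the counting (`≤ 2` states per reading ball, `≤ 2·deg` reached states per ball)
is the next file; F-C1 not moved.
-/

noncomputable section

namespace Summit.Ventures.Crystal3D.Theorems

open Summit.Ventures.Crystal3D Finset
open Literature.MathematicalPhysics.StatisticalMechanics (fccStacking)
open scoped InnerProductSpace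

variable {X : Finset (EuclideanSpace ℝ (Fin 3))}

open scoped Classical in
/-- **The contacts of a ball reading as a twin dozen are its nine own slot balls and its three mirror balls.** -/
theorem mem_shell_of_twinDozen (hX : ∀ p ∈ X, ∀ q ∈ X, p ≠ q → 1 ≤ dist p q)
    (G : EuclideanSpace ℝ (Fin 3) ≃ₗᵢ[ℝ] EuclideanSpace ℝ (Fin 3)) {m : EuclideanSpace ℝ (Fin 3)} (hm : ‖m‖ = 1)
    {y : EuclideanSpace ℝ (Fin 3)}
    (hown : ∀ w ∈ fccSlots, ⟪G w, m⟫_ℝ ≤ 0 → y + G w ∈ X)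
    (hmir : ∀ w ∈ fccSlots, ⟪G w, m⟫_ℝ < 0 → y + (G w - (2 * ⟪G w, m⟫_ℝ) • m) ∈ X)
    {q : EuclideanSpace ℝ (Fin 3)} (hq : q ∈ X) (hdq : dist y q = 1) :
    (∃ w ∈ fccSlots, ⟪G w, m⟫_ℝ ≤ 0 ∧ q = y + G w) ∨
      (∃ w ∈ fccSlots, ⟪G w, m⟫_ℝ < 0 ∧ q = y + (G w - (2 * ⟪G w, m⟫_ℝ) • m)) := by
  -- the explicit twelve
  set S : Finset (EuclideanSpace ℝ (Fin 3)) :=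
    ((fccSlots.filter fun w => ⟪G w, m⟫_ℝ ≤ 0).image fun w => y + G w) ∪
      ((fccSlots.filter fun w => ⟪G w, m⟫_ℝ < 0).image fun w => y + (G w - (2 * ⟪G w, m⟫_ℝ) • m)) with hS
  have hSsub : S ⊆ X.filter fun q => dist y q = 1 := by
    intro x hx
    rw [hS, mem_union] at hx
    rw [mem_filter]
    rcases hx with hx | hx
    · obtain ⟨w, hw, rfl⟩ := mem_image.1 hx
      obtain ⟨hwS, hle⟩ := mem_filter.1 hw
      exact ⟨hown w hwS hle, by rw [dist_self_add_right, LinearIsometryEquiv.norm_map, norm_eq_one_of_mem_fccSlots hwS]⟩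
    · obtain ⟨w, hw, rfl⟩ := mem_image.1 hx
      obtain ⟨hwS, hlt⟩ := mem_filter.1 hw
      refine ⟨hmir w hwS hlt, ?_⟩
      rw [dist_self_add_right, norm_sub_two_mul_inner_smul hm, LinearIsometryEquiv.norm_map,
        norm_eq_one_of_mem_fccSlots hwS]
  -- by cardinality `S` is the whole contact shell
  have h12 := card_contacts_eq_twelve_of_twinDozen hX G hm hown hmir
  have hScard : 12 ≤ S.card := by
    -- the reading map of `…EndGap` lands in `S`
    rw [← card_fccSlots]
    set φ : EuclideanSpace ℝ (Fin 3) → EuclideanSpace ℝ (Fin 3) := fun w =>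
      if ⟪G w, m⟫_ℝ ≤ 0 then y + G w else y + (G (-w) - (2 * ⟪G (-w), m⟫_ℝ) • m) with hφ
    have mm : ⟪m, m⟫_ℝ = 1 := by rw [real_inner_self_eq_norm_sq, hm, one_pow]
    have hmirval : ∀ w : EuclideanSpace ℝ (Fin 3), ⟪G (-w) - (2 * ⟪G (-w), m⟫_ℝ) • m, m⟫_ℝ = ⟪G w, m⟫_ℝ := by
      intro w
      rw [inner_sub_left, real_inner_smul_left, mm, map_neg, inner_neg_left]; ring
    refine Finset.card_le_card_of_injOn φ (fun w hw => ?_) ?_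
    · have hw' := Finset.mem_coe.1 hw
      rw [Finset.mem_coe, hS, mem_union]
      by_cases hle : ⟪G w, m⟫_ℝ ≤ 0
      · simp only [hφ, hle, if_true]
        exact Or.inl (mem_image.2 ⟨w, mem_filter.2 ⟨hw', hle⟩, rfl⟩)
      · simp only [hφ, hle, if_false]
        have hneg : ⟪G (-w), m⟫_ℝ < 0 := by rw [map_neg, inner_neg_left]; linarith
        exact Or.inr (mem_image.2 ⟨-w, mem_filter.2 ⟨neg_mem_fccSlots hw', hneg⟩, rfl⟩)
    · intro w₁ hw₁ w₂ hw₂ h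
      by_cases h₁ : ⟪G w₁, m⟫_ℝ ≤ 0 <;> by_cases h₂ : ⟪G w₂, m⟫_ℝ ≤ 0
      · simp only [hφ, h₁, h₂, if_true] at h
        exact G.injective (add_left_cancel h)
      · exfalso
        simp only [hφ, h₁, h₂, if_true, if_false] at h
        have := congrArg (fun x => ⟪x - y, m⟫_ℝ) h
        simp only [add_sub_cancel_left, hmirval] at this
        linarith
      · exfalso
        simp only [hφ, h₁, h₂, if_true, if_false] at h
        have := congrArg (fun x => ⟪x - y, m⟫_ℝ) h
        simp only [add_sub_cancel_left, hmirval] at this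
        linarith
      · simp only [hφ, h₁, h₂, if_false] at h
        have h' := add_left_cancel h
        have e : ∀ x : EuclideanSpace ℝ (Fin 3),
            (x - (2 * ⟪x, m⟫_ℝ) • m) - (2 * ⟪x - (2 * ⟪x, m⟫_ℝ) • m, m⟫_ℝ) • m = x := by
          intro x
          rw [inner_sub_left, real_inner_smul_left, mm]
          module
        have := congrArg (fun x => x - (2 * ⟪x, m⟫_ℝ) • m) h'
        simp only [e] at this
        exact neg_injective (G.injective this)
  have hSeq : S = X.filter fun q => dist y q = 1 :=
    Finset.eq_of_subset_of_card_le hSsub (by rw [h12]; exact hScard)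
  have hqS : q ∈ S := by rw [hSeq]; exact mem_filter.2 ⟨hq, hdq⟩
  rw [hS, mem_union] at hqS
  rcases hqS with h | h
  · obtain ⟨w, hw, hwq⟩ := mem_image.1 h
    obtain ⟨hwS, hle⟩ := mem_filter.1 hw
    exact Or.inl ⟨w, hwS, hle, hwq.symm⟩
  · obtain ⟨w, hw, hwq⟩ := mem_image.1 h
    obtain ⟨hwS, hlt⟩ := mem_filter.1 hw
    exact Or.inr ⟨w, hwS, hlt, hwq.symm⟩

section Word

variable {K : Type*} {F : K → (EuclideanSpace ℝ (Fin 3) ≃ₗᵢ[ℝ] EuclideanSpace ℝ (Fin 3))}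
  {d : K → EuclideanSpace ℝ (Fin 3)} {next : K → EuclideanSpace ℝ (Fin 3) → K}
  {W : Finset (EuclideanSpace ℝ (Fin 3) × K)}
  {f : EuclideanSpace ℝ (Fin 3) × K → EuclideanSpace ℝ (Fin 3) × K}

/-- **A ball with a full `F κ`-shell carries only the class `κ`** (word rigidity). -/
theorem word_class_eq_of_full (hX : ∀ p ∈ X, ∀ q ∈ X, p ≠ q → 1 ≤ dist p q)
    (hW : ∀ v, v ∈ W ↔ (v.1 ∈ X ∧
      (∃ a ∈ fccSlots, ∃ a' ∈ fccSlots, ∃ a'' ∈ fccSlots,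
        ⟪a, a'⟫_ℝ = 1 / 2 ∧ ⟪a, a''⟫_ℝ = 1 / 2 ∧ ⟪a', a''⟫_ℝ = 1 / 2 ∧
        v.1 + F v.2 a ∈ X ∧ v.1 + F v.2 a' ∈ X ∧ v.1 + F v.2 a'' ∈ X) ∧
      v.1 - d v.2 ∈ X))
    (hrigid : ∀ κ₁ κ₂ : K, (∃ a ∈ fccSlots, ∃ a' ∈ fccSlots, ∃ a'' ∈ fccSlots,
        ⟪a, a'⟫_ℝ = 1 / 2 ∧ ⟪a, a''⟫_ℝ = 1 / 2 ∧ ⟪a', a''⟫_ℝ = 1 / 2 ∧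
        (∃ w ∈ fccSlots, F κ₂ w = F κ₁ a) ∧ (∃ w ∈ fccSlots, F κ₂ w = F κ₁ a') ∧
        (∃ w ∈ fccSlots, F κ₂ w = F κ₁ a'')) → κ₁ = κ₂)
    {p : EuclideanSpace ℝ (Fin 3)} {κ : K} (hfull : ∀ w ∈ fccSlots, p + F κ w ∈ X)
    {v : EuclideanSpace ℝ (Fin 3) × K} (hv : v ∈ W) (hvp : v.1 = p) : v.2 = κ := by
  obtain ⟨-, ⟨a, ha, a', ha', a'', ha'', i1, i2, i3, h1, h2, h3⟩, -⟩ := (hW v).1 hv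
  rw [hvp] at h1 h2 h3
  refine hrigid v.2 κ ⟨a, ha, a', ha', a'', ha'', i1, i2, i3, ?_, ?_, ?_⟩
  · exact shell_slot_of_full hX (F κ) hfull h1 (by rw [LinearIsometryEquiv.norm_map, norm_eq_one_of_mem_fccSlots ha])
  · exact shell_slot_of_full hX (F κ) hfull h2 (by rw [LinearIsometryEquiv.norm_map, norm_eq_one_of_mem_fccSlots ha'])
  · exact shell_slot_of_full hX (F κ) hfull h3 (by rw [LinearIsometryEquiv.norm_map, norm_eq_one_of_mem_fccSlots ha''])

/-- **A ball reading as a twin dozen of `(F κ, m)` carries `κ` and at most one mirrored class**: every certified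
state `(p, κ')` there has `κ' = κ`, or a `60°` triangle of `F κ'`-slots inside the mirrored dozen
`(F κ ≫ R_m) '' fccSlots`. -/
theorem word_class_of_twinDozen (hX : ∀ p ∈ X, ∀ q ∈ X, p ≠ q → 1 ≤ dist p q)
    (hW : ∀ v, v ∈ W ↔ (v.1 ∈ X ∧
      (∃ a ∈ fccSlots, ∃ a' ∈ fccSlots, ∃ a'' ∈ fccSlots,
        ⟪a, a'⟫_ℝ = 1 / 2 ∧ ⟪a, a''⟫_ℝ = 1 / 2 ∧ ⟪a', a''⟫_ℝ = 1 / 2 ∧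
        v.1 + F v.2 a ∈ X ∧ v.1 + F v.2 a' ∈ X ∧ v.1 + F v.2 a'' ∈ X) ∧
      v.1 - d v.2 ∈ X))
    (hrigid : ∀ κ₁ κ₂ : K, (∃ a ∈ fccSlots, ∃ a' ∈ fccSlots, ∃ a'' ∈ fccSlots,
        ⟪a, a'⟫_ℝ = 1 / 2 ∧ ⟪a, a''⟫_ℝ = 1 / 2 ∧ ⟪a', a''⟫_ℝ = 1 / 2 ∧
        (∃ w ∈ fccSlots, F κ₂ w = F κ₁ a) ∧ (∃ w ∈ fccSlots, F κ₂ w = F κ₁ a') ∧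
        (∃ w ∈ fccSlots, F κ₂ w = F κ₁ a'')) → κ₁ = κ₂)
    {p : EuclideanSpace ℝ (Fin 3)} {κ : K} {m : EuclideanSpace ℝ (Fin 3)} (hm : ‖m‖ = 1)
    (hmenu : ∀ w ∈ fccSlots, ⟪F κ w, m⟫_ℝ = 0 ∨ ⟪F κ w, m⟫_ℝ = Real.sqrt (2 / 3) ∨ ⟪F κ w, m⟫_ℝ = -Real.sqrt (2 / 3))
    (hown : ∀ w ∈ fccSlots, ⟪F κ w, m⟫_ℝ ≤ 0 → p + F κ w ∈ X)
    (hmir : ∀ w ∈ fccSlots, ⟪F κ w, m⟫_ℝ < 0 → p + (F κ w - (2 * ⟪F κ w, m⟫_ℝ) • m) ∈ X)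
    {v : EuclideanSpace ℝ (Fin 3) × K} (hv : v ∈ W) (hvp : v.1 = p) :
    v.2 = κ ∨ ∃ a ∈ fccSlots, ∃ a' ∈ fccSlots, ∃ a'' ∈ fccSlots,
        ⟪a, a'⟫_ℝ = 1 / 2 ∧ ⟪a, a''⟫_ℝ = 1 / 2 ∧ ⟪a', a''⟫_ℝ = 1 / 2 ∧
        F v.2 a ∈ (((F κ).trans (ℝ ∙ m)ᗮ.reflection : EuclideanSpace ℝ (Fin 3) → EuclideanSpace ℝ (Fin 3)) '' ↑fccSlots) ∧
        F v.2 a' ∈ (((F κ).trans (ℝ ∙ m)ᗮ.reflection : EuclideanSpace ℝ (Fin 3) → EuclideanSpace ℝ (Fin 3)) '' ↑fccSlots) ∧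
        F v.2 a'' ∈ (((F κ).trans (ℝ ∙ m)ᗮ.reflection : EuclideanSpace ℝ (Fin 3) → EuclideanSpace ℝ (Fin 3)) '' ↑fccSlots) := by
  have h23 : Real.sqrt (2 / 3) ^ 2 = 2 / 3 := Real.sq_sqrt (by norm_num)
  have hr : 0 < Real.sqrt (2 / 3) := Real.sqrt_pos.2 (by norm_num)
  obtain ⟨-, ⟨a, ha, a', ha', a'', ha'', i1, i2, i3, h1, h2, h3⟩, -⟩ := (hW v).1 hv
  rw [hvp] at h1 h2 h3
  -- the mirrored frame as an isometry
  set L : EuclideanSpace ℝ (Fin 3) ≃ₗᵢ[ℝ] EuclideanSpace ℝ (Fin 3) := (F κ).trans (ℝ ∙ m)ᗮ.reflection with hL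
  have hLapp : ∀ x, L x = F κ x - (2 * ⟪F κ x, m⟫_ℝ) • m := fun x => by
    rw [hL, LinearIsometryEquiv.trans_apply, reflection_unit_apply hm]
  -- each vertex of the triangle is an own slot ball or a mirror ball
  have hvert : ∀ {x : EuclideanSpace ℝ (Fin 3)}, x ∈ fccSlots → p + F v.2 x ∈ X →
      (∃ w ∈ fccSlots, ⟪F κ w, m⟫_ℝ ≤ 0 ∧ F v.2 x = F κ w) ∨
        (∃ w ∈ fccSlots, ⟪F κ w, m⟫_ℝ < 0 ∧ F v.2 x = F κ w - (2 * ⟪F κ w, m⟫_ℝ) • m) := by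
    intro x hx hxX
    have hdist : dist p (p + F v.2 x) = 1 := by
      rw [dist_self_add_right, LinearIsometryEquiv.norm_map, norm_eq_one_of_mem_fccSlots hx]
    rcases mem_shell_of_twinDozen hX (F κ) hm hown hmir hxX hdist with ⟨w, hw, hle, he⟩ | ⟨w, hw, hlt, he⟩
    · exact Or.inl ⟨w, hw, hle, (add_left_cancel he).symm ▸ rfl⟩
    · exact Or.inr ⟨w, hw, hlt, (add_left_cancel he).symm ▸ rfl⟩
  -- a negative own ball and a mirror ball are never adjacent
  have hnomix : ∀ {x x' : EuclideanSpace ℝ (Fin 3)}, ⟪x, x'⟫_ℝ = 1 / 2 → x ∈ fccSlots → x' ∈ fccSlots →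
      ∀ {w w' : EuclideanSpace ℝ (Fin 3)}, w ∈ fccSlots → w' ∈ fccSlots →
      ⟪F κ w, m⟫_ℝ < 0 → F v.2 x = F κ w - (2 * ⟪F κ w, m⟫_ℝ) • m →
      ⟪F κ w', m⟫_ℝ ≤ 0 → F v.2 x' = F κ w' → ⟪F κ w', m⟫_ℝ = 0 := by
    intro x x' hxx' hx hx' w w' hw hw' hlt he hle he'
    rcases hmenu w' hw' with h0 | hp | hn
    · exact h0
    · rw [hp] at hle; linarith
    · exfalso
      have hwn : ⟪F κ w, m⟫_ℝ = -Real.sqrt (2 / 3) := by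
        rcases hmenu w hw with h0 | hp | hn'
        · rw [h0] at hlt; exact absurd hlt (lt_irrefl 0)
        · rw [hp] at hlt; linarith
        · exact hn'
      have key : ⟪F v.2 x, F v.2 x'⟫_ℝ = ⟪w, w'⟫_ℝ - 4 / 3 := by
        rw [he, he', inner_sub_left, real_inner_smul_left, LinearIsometryEquiv.inner_map_map,
          real_inner_comm (F κ w'), hwn, hn]
        nlinarith [h23]
      rw [LinearIsometryEquiv.inner_map_map, hxx'] at key
      have hb : ⟪w, w'⟫_ℝ ≤ 1 := by
        have := real_inner_le_norm w w'
        rwa [norm_eq_one_of_mem_fccSlots hw, norm_eq_one_of_mem_fccSlots hw', one_mul] at this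
      linarith
  -- an own ball on the plane is in the mirrored frame; a mirror ball is too
  have hexL : ∀ {x w' : EuclideanSpace ℝ (Fin 3)}, w' ∈ fccSlots → ⟪F κ w', m⟫_ℝ = 0 → F v.2 x = F κ w' →
      F v.2 x ∈ (L : EuclideanSpace ℝ (Fin 3) → EuclideanSpace ℝ (Fin 3)) '' ↑fccSlots := by
    intro x w' hw' h0 he'
    refine ⟨w', Finset.mem_coe.2 hw', ?_⟩
    rw [hLapp, h0, mul_zero, zero_smul, sub_zero, he']
  have hmirL : ∀ {x w : EuclideanSpace ℝ (Fin 3)}, w ∈ fccSlots → F v.2 x = F κ w - (2 * ⟪F κ w, m⟫_ℝ) • m →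
      F v.2 x ∈ (L : EuclideanSpace ℝ (Fin 3) → EuclideanSpace ℝ (Fin 3)) '' ↑fccSlots := by
    intro x w hw he
    exact ⟨w, Finset.mem_coe.2 hw, by rw [hLapp, he]⟩
  have i21 : ⟪a', a⟫_ℝ = 1 / 2 := by rw [real_inner_comm]; exact i1
  have i31 : ⟪a'', a⟫_ℝ = 1 / 2 := by rw [real_inner_comm]; exact i2
  have i32 : ⟪a'', a'⟫_ℝ = 1 / 2 := by rw [real_inner_comm]; exact i3
  rcases hvert ha h1 with ⟨w₁, hw₁, hle₁, e₁⟩ | ⟨w₁, hw₁, hlt₁, e₁⟩ <;>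
    rcases hvert ha' h2 with ⟨w₂, hw₂, hle₂, e₂⟩ | ⟨w₂, hw₂, hlt₂, e₂⟩ <;>
    rcases hvert ha'' h3 with ⟨w₃, hw₃, hle₃, e₃⟩ | ⟨w₃, hw₃, hlt₃, e₃⟩
  · -- all own: a triangle inside `F κ`'s slots
    exact Or.inl (hrigid v.2 κ ⟨a, ha, a', ha', a'', ha'', i1, i2, i3, ⟨w₁, hw₁, e₁.symm⟩, ⟨w₂, hw₂, e₂.symm⟩,
      ⟨w₃, hw₃, e₃.symm⟩⟩)
  all_goals right; refine ⟨a, ha, a', ha', a'', ha'', i1, i2, i3, ?_, ?_, ?_⟩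
  -- own, own, mirror
  · exact hexL hw₁ (hnomix i31 ha'' ha hw₃ hw₁ hlt₃ e₃ hle₁ e₁) e₁
  · exact hexL hw₂ (hnomix i32 ha'' ha' hw₃ hw₂ hlt₃ e₃ hle₂ e₂) e₂
  · exact hmirL hw₃ e₃
  -- own, mirror, own
  · exact hexL hw₁ (hnomix i21 ha' ha hw₂ hw₁ hlt₂ e₂ hle₁ e₁) e₁
  · exact hmirL hw₂ e₂
  · exact hexL hw₃ (hnomix i3 ha' ha'' hw₂ hw₃ hlt₂ e₂ hle₃ e₃) e₃
  -- own, mirror, mirror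
  · exact hexL hw₁ (hnomix i21 ha' ha hw₂ hw₁ hlt₂ e₂ hle₁ e₁) e₁
  · exact hmirL hw₂ e₂
  · exact hmirL hw₃ e₃
  -- mirror, own, own
  · exact hmirL hw₁ e₁
  · exact hexL hw₂ (hnomix i1 ha ha' hw₁ hw₂ hlt₁ e₁ hle₂ e₂) e₂
  · exact hexL hw₃ (hnomix i2 ha ha'' hw₁ hw₃ hlt₁ e₁ hle₃ e₃) e₃
  -- mirror, own, mirror
  · exact hmirL hw₁ e₁
  · exact hexL hw₂ (hnomix i1 ha ha' hw₁ hw₂ hlt₁ e₁ hle₂ e₂) e₂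
  · exact hmirL hw₃ e₃
  -- mirror, mirror, own
  · exact hmirL hw₁ e₁
  · exact hmirL hw₂ e₂
  · exact hexL hw₃ (hnomix i2 ha ha'' hw₁ hw₃ hlt₁ e₁ hle₃ e₃) e₃
  -- all mirror
  · exact hmirL hw₁ e₁
  · exact hmirL hw₂ e₂
  · exact hmirL hw₃ e₃

end Word

end Summit.Ventures.Crystal3D.Theorems

end
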